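/-
Copyright (c) 2026 the pub-hodgecm2 formalisation cell (harness21).  New file, outside the frozen port manifest.
Origin: seat `prover-pub-hodgecm2-d2bridge-prove-2-g0-0` (unit pub-hodgecm2-d2bridge-prove-2, Δ2 BRIDGE team; «M-half of X1» per ASSEMBLER
DECISION #3, pub-hodgecm2/INBOX l.10797), 2026-08-23.  Definitions (one `Module` structure, as a `def`, never an instance) + theorems;
no named fact, no `sorry`, no new axiom; count-neutral; HC_CM is NOT proved; «Δ2 BRIDGE CLOSED» is NOT claimed.
-/
import Literature.NumberTheory.Automorphic.Liu2021.AppendixC.RestOne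
import Literature.AlgebraicGeometry.ComplexMultiplication.CMFieldActionHOne
import Literature.LinearAlgebra.BaseChange.NumberFieldLineEigenline
import Literature.NumberTheory.ComplexMultiplication.ShimuraTaniyamaHecke
import HarnessLib

set_option autoImplicit false

/-!
# Δ2 bridge, the record `M` at the one-object rest — the CM LINE `L = H¹_B(A_μ ⊗_{E,ι₁} ℂ; ℚ)`: `M_μ`-module structure through
# `i_μ`, rank one, and the eigenvector `α`

Y. Liu, *Fourier–Jacobi cycles and arithmetic relative trace formula*, Camb. J. Math. **9** (2021) 1–147 = arXiv:2102.11518 [Liu2021];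
TeX source `FJcycle.tex` (md5 `6db49a74122d…`; `l. NNNN` = its lines).

## What this file is

The proof-objects record `M : Map43RationalData` of [Liu2021] Thm. 4.18 (proof, l. 2247–2253; tree `Liu2021/Thm418ProofMapRational.lean`;
the Δ2 binder group R2 «`M`», assembled generically in `CorCM/D2Bridge/OmegaLevelwisePullbackLaws.lean` § 7 `map43RecordOfLevels`) has a
CM-SIDE block: the `ℚ`-space `L = H¹_{B,τ'}(A_μ, ℚ)` «as a module over `M_μ` through `i_μ : M_μ → End_E(A_μ)_ℚ` (Def. 4.5 (2), l. 1948)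
and functoriality of `H¹`», FREE OF RANK ONE («`A_μ` has dimension `[M_μ:ℚ]/2`», l. 650, with the CM structure), and the chosen vector
`α ∈ ℂ ⊗_ℚ L` «on which `M_μ` acts via the inclusion `M_μ ↪ ℂ`», non-zero (l. 2250).  THIS FILE supplies that block, hole-free, at the
tree's one-object rest (`Liu2021/AppendixC/RestOne.lean`: the chosen `D_μ ∈ 𝒜(μ)`, `A_μ = AμOne D`, `i_μ = iOne D`, «`M_μ` acts via `i_μ`» =
the scoped `EndScalar` instance `endScalarOne`):

* §1 generic, for a complex abelian variety `B` and a ring homomorphism `j : S → End⁰(B)` from an intermediate field `S` of `ℂ/ℚ` with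
  `[S:ℚ] = 2 dim B`: the `S`-module structure `lineModule` on `H¹(B(ℂ); ℚ)` (`s ↦ (j s)^*`, the tree's `hOneRingHom`; a `def`, NOT an
  instance), its scalar tower over `ℚ`, **`finrank_lineModule : dim_S H¹(B(ℂ); ℚ) = 1`** (tree `finrank_bettiCohomology_one` «`b₁ = 2g`» +
  `LinearAlgebra/BaseChange/NumberFieldLineEigenline.finrank_eq_one_of_finrank_rat_eq`), **`exists_eigenvector`** (a non-zero `α` with
  `(s • ·) ⊗ ℂ α = s · α`, LITERALLY the `α_mem ∕ α_ne` fields of `Map43RationalData`; tree `exists_mem_eigenlineOf_ne_zero`), and the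
  `ℚ`-linear action `endStarQ : End⁰(B) → End_ℚ H¹(B(ℂ); ℚ)` (`bettiRep`, un-opposed) with `smul_eq_endStarQ` (the `hmod` input of
  `map43RecordOfLevels`, by `rfl`) and `endStarQ_of` (`(1 ⊗ β) ↦ β^*`);
* §2 at the one-object rest: `B := (AμOne D) ⊗_E ℂ` (along the consumer's `Algebra E ℂ`, at the pin `ι₁`), `S := M_μ = fieldOfValues E μ`,
  `j := (End⁰ base change) ∘ i_μ ∘ ofFieldOfValues` (`jOne`); `[M_μ:ℚ] = 2 dim A_μ` is the PROJECTION `RestOne.hdimOne` of the chosen Def. 4.5 (2)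
  datum (READING I1-R3 of `Def45AsPrinted`) transported along `fieldOfValues ≃ muAlgValueField` and `dim_baseChange`; whence
  `finrank_lineModuleOne`, `exists_eigenvectorOne`, `endStarQOne ∕ smul_eq_endStarQOne`.

Nothing about Liu's objects is asserted; no pin is discharged (the record `M` itself is port-gated through the J-half); HC_CM is NOT proved;
«Δ2 BRIDGE CLOSED» is NOT claimed.

## References
* [Liu2021] l. 650; Def. 4.5 (2) (l. 1944–1951); proof of Thm. 4.18 (l. 2247–2253).
* [Deligne1982HodgeCycles] P. Deligne, *Hodge cycles on abelian varieties*, LNM 900, Example 3.7, §4 p. 30 (`dim_ℂ V_{ℂ,σ} = dim_E V`).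
* [MumfordAV1970] D. Mumford, *Abelian Varieties*, §1 (3) (`b₁ = 2g`), §19 (`End⁰`).
* Tree: `ComplexMultiplication/CMFieldActionHOne.lean` (`hOneRingHom`), `ComplexMultiplication/EndAlgebraCommSubalgebraDegreeBound.lean`
  (`bettiRep`), `HodgeTheory/WeilTypeRationalDatum.lean` (`finrank_bettiCohomology_one`), `LinearAlgebra/BaseChange/NumberFieldLineEigenline.lean`,
  `Liu2021/AppendixC/RestOne.lean`, `NumberTheory/ComplexMultiplication/ShimuraTaniyamaHecke.lean` (`endBaseChange`).
-/

noncomputable section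

open scoped TensorProduct
open CategoryTheory NumberField
open Literature.AlgebraicGeometry.Motives (AbelianVariety bettiCohomology)
open Literature.AlgebraicGeometry.ComplexMultiplication (bettiRep bettiRep_of hOneRingHom hOneRingHom_apply)
open Literature.AlgebraicGeometry.HodgeTheory (finrank_bettiCohomology_one finite_bettiCohomology_one)
open Literature.LinearAlgebra.BaseChange (eigenlineOf mem_eigenlineOf exists_mem_eigenlineOf_ne_zero finrank_eq_one_of_finrank_rat_eq)

namespace Summit.HodgeConjecture.CorCM.D2Bridge

/-! ## §1  Generic: `H¹(B(ℂ); ℚ)` as a line over a subfield `S ⊆ ℂ` acting through `j : S → End⁰(B)` -/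

section Generic

variable (B : AbelianVariety ℂ) (S : IntermediateField ℚ ℂ) (j : S →+* B.endAlgebra)

/-- **The `S`-module structure on `H¹(B(ℂ); ℚ)` through `j : S → End⁰(B)`**, `s • x := (j s)^* x` (the tree's `hOneRingHom j`, [Liu2021]
Def. 4.16 l. 2219 / Def. 4.5 (2) l. 1948 «`M_μ` acts via `i_μ`» read on `H¹` by functoriality).  A `def` (activate with `letI`), never an
instance. [cite: Liu2021, Def. 4.5 (2) (FJcycle.tex l. 1948) and Def. 4.16 (l. 2219)] -/
abbrev lineModule : Module S (bettiCohomology B.X 1) :=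
  Module.compHom (bettiCohomology B.X 1) (hOneRingHom j)

/-- Unfolding of the action: `s • x = (j s)^* x`. [cite: Liu2021, Def. 4.16 (FJcycle.tex l. 2219)] -/
theorem lineModule_smul_def (s : S) (x : bettiCohomology B.X 1) :
    (letI := lineModule B S j; s • x) = hOneRingHom j s x :=
  rfl

/-- The action is compatible with the `ℚ`-structure (`hOneRingHom j` is additive between `ℚ`-vector spaces, hence `ℚ`-linear). [folklore] -/
theorem isScalarTower_lineModule : letI := lineModule B S j; IsScalarTower ℚ S (bettiCohomology B.X 1) := by
  letI := lineModule B S j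
  refine ⟨fun q s x => ?_⟩
  change hOneRingHom j (q • s) x = q • hOneRingHom j s x
  rw [map_rat_smul (hOneRingHom j) q s, LinearMap.smul_apply]

/-- **The `ℚ`-linear action of `End⁰(B)` on `H¹(B(ℂ); ℚ)`**, `e ↦ e^*` (the tree's rational representation `bettiRep`, un-opposed; `ℚ`-linear,
an ANTI-homomorphism of rings). [cite: MumfordAV1970, §19 (the representation of `End⁰` on `H¹`)] -/
def endStarQ : B.endAlgebra →ₗ[ℚ] Module.End ℚ (bettiCohomology B.X 1) :=
  ((MulOpposite.opLinearEquiv ℚ).symm : (Module.End ℚ (bettiCohomology B.X 1))ᵐᵒᵖ ≃ₗ[ℚ] _).toLinearMap ∘ₗ (bettiRep B).toLinearMap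

/-- Unfolding: `endStarQ B e = unop (bettiRep B e)`. [folklore] -/
theorem endStarQ_apply (e : B.endAlgebra) : endStarQ B e = MulOpposite.unop (bettiRep B e) := rfl

/-- On `1 ⊗ β`, `β ∈ End B`, the action is the pull-back `β^*`. [cite: MumfordAV1970, §19] -/
theorem endStarQ_of (β : End B) :
    endStarQ B (AbelianVariety.endAlgebra.of B β) = (bettiCohomology.map β.hom.hom.hom 1).hom := by
  rw [endStarQ_apply, bettiRep_of, MulOpposite.unop_op]

/-- **`hmod` by `rfl`**: the `S`-action IS `endStarQ ∘ j` (the input `hmod` of `OmegaLevelwisePullbackLaws.map43RecordOfLevels`).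
[cite: Liu2021, Def. 4.16 (FJcycle.tex l. 2219)] -/
theorem smul_eq_endStarQ (s : S) (x : bettiCohomology B.X 1) :
    (letI := lineModule B S j; s • x) = endStarQ B (j s) x :=
  rfl

variable [FiniteDimensional ℚ S]

/-- **`H¹(B(ℂ); ℚ)` is an `S`-LINE when `[S:ℚ] = 2 dim B`** (`b₁ = 2g`, tree `finrank_bettiCohomology_one`; an `S`-module of `ℚ`-dimension
`[S:ℚ]` is a line, tree `finrank_eq_one_of_finrank_rat_eq`) — the field `rank_L` of `Map43RationalData` («`A_μ` has dimension `[M_μ:ℚ]/2`»,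
l. 650, with the CM structure `i_μ`). [cite: Liu2021, l. 650 with Def. 4.5 (2)] [cite: Deligne1982HodgeCycles, I §4 p. 30] -/
theorem finrank_lineModule (hdim : Module.finrank ℚ S = 2 * B.dim) :
    letI := lineModule B S j; Module.finrank S (bettiCohomology B.X 1) = 1 := by
  letI := lineModule B S j
  haveI := isScalarTower_lineModule B S j
  exact finrank_eq_one_of_finrank_rat_eq S (bettiCohomology B.X 1) (by rw [finrank_bettiCohomology_one, hdim])

/-- **The eigenvector `α`** («We choose a basis `α` of this subspace», l. 2250): a NON-ZERO `α ∈ ℂ ⊗_ℚ H¹(B(ℂ); ℚ)` with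
`((s • ·) ⊗ ℂ) α = s · α` for every `s ∈ S` — LITERALLY the fields `α_mem ∕ α_ne` of `Map43RationalData` for the module structure `lineModule`
(tree `exists_mem_eigenlineOf_ne_zero`: the eigenline of a number-field line is a line).
[cite: Liu2021, proof of Thm. 4.18 (FJcycle.tex l. 2250)] [cite: Deligne1982HodgeCycles, I Example 3.7] -/
theorem exists_eigenvector (hdim : Module.finrank ℚ S = 2 * B.dim) :
    letI := lineModule B S j
    ∃ α : ℂ ⊗[ℚ] bettiCohomology B.X 1,
      (∀ s : S, (DistribSMul.toLinearMap ℚ (bettiCohomology B.X 1) s).baseChange ℂ α = algebraMap S ℂ s • α) ∧ α ≠ 0 := by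
  letI := lineModule B S j
  haveI := isScalarTower_lineModule B S j
  obtain ⟨α, hα, h0⟩ := exists_mem_eigenlineOf_ne_zero (M := S) (bettiCohomology B.X 1) (finrank_lineModule B S j hdim)
  exact ⟨α, fun s => (mem_eigenlineOf.1 hα) s, h0⟩

/-- The eigenvector property in the `hOneRingHom` currency (the shape of prove-1's S1 input `hα₀`): `((j s)^*) ⊗ ℂ α = s · α`.
[cite: Liu2021, proof of Thm. 4.18 (FJcycle.tex l. 2250)] -/
theorem exists_eigenvector' (hdim : Module.finrank ℚ S = 2 * B.dim) :
    ∃ α : ℂ ⊗[ℚ] bettiCohomology B.X 1, (∀ s : S, (hOneRingHom j s).baseChange ℂ α = (s : ℂ) • α) ∧ α ≠ 0 := by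
  obtain ⟨α, hα, h0⟩ := exists_eigenvector B S j hdim
  refine ⟨α, fun s => ?_, h0⟩
  have h := hα s
  have e : (letI := lineModule B S j; DistribSMul.toLinearMap ℚ (bettiCohomology B.X 1) s) = hOneRingHom j s :=
    LinearMap.ext fun x => rfl
  rw [e] at h
  exact h

end Generic

/-! ## §2  At the one-object rest: `L = H¹_B(A_μ ⊗_E ℂ; ℚ)` over `M_μ = fieldOfValues E μ` through `i_μ` -/

section OneObject

open Literature.NumberTheory.Automorphic Literature.NumberTheory.Automorphic.Liu2021
open Literature.NumberTheory.Automorphic.Liu2021.AppendixC.RestOne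

variable {E : Type} [Field E] [NumberField E] [IsCMField E] [Algebra E ℂ]
variable {Lg : Type} [Field Lg] [NumberField Lg] [IsGalois ℚ Lg] (emb : E →ₐ[ℚ] Lg) (ιg : Lg →+* ℂ)
variable {μ : IdeleClassGroup E →ₜ* Circle} (hμ : IdeleClassGroup.IsConjugateSymplectic E μ)
  (hw : IdeleClassGroup.HasWeight E μ 1) (Car : Def45.Carriers E μ)

/-- `A_μ ⊗_E ℂ`, the complex abelian variety of the chosen object `D_μ` (base change along the consumer's `Algebra E ℂ`; at the pin `ι₁`).
[cite: Liu2021, proof of Thm. 4.18 (FJcycle.tex l. 2250)] -/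
abbrev AμC (D : ObjOne emb ιg hμ hw Car) : AbelianVariety ℂ := (AμOne emb ιg hμ hw Car D).baseChange ℂ

/-- **`j = (base change) ∘ i_μ ∘ (fieldOfValues → muAlgValueField)`**: `M_μ → End⁰(A_μ ⊗ ℂ)` — «`M_μ` acts via `i_μ`» (Def. 4.16 l. 2219,
Def. 4.5 (2) l. 1948) followed by «`End_E(A_μ) ⊆ End_ℂ(A_μ ⊗ ℂ)`» (tree `AbelianVariety.endBaseChange`). [cite: Liu2021, Def. 4.5 (2) (FJcycle.tex l. 1948)] -/
def jOne (D : ObjOne emb ιg hμ hw Car) : fieldOfValues E μ →+* (AμC emb ιg hμ hw Car D).endAlgebra :=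
  (AbelianVariety.endAlgebra.mapRingHom ((AμOne emb ιg hμ hw Car D).endBaseChange ℂ)).toRingHom.comp
    ((iOne emb ιg hμ hw Car D).comp (ofFieldOfValues E μ))

omit [IsCMField E] [Algebra E ℂ] in
/-- The as-printed `M_μ` and the tree's `M_μ` have the same degree (`fieldOfValues_toSubfield`: same underlying subfield of `ℂ`).
[cite: Liu2021, §4.1 (FJcycle.tex l. 1926–1928)] -/
theorem finrank_fieldOfValues_eq :
    Module.finrank ℚ (fieldOfValues E μ) = Module.finrank ℚ (IdeleClassGroup.muAlgValueField E μ) := by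
  let f : fieldOfValues E μ →ₐ[ℚ] IdeleClassGroup.muAlgValueField E μ :=
    { toFun := fun z => ⟨(z : ℂ), (mem_fieldOfValues_iff E μ z).1 z.2⟩
      map_one' := rfl
      map_mul' := fun _ _ => rfl
      map_zero' := rfl
      map_add' := fun _ _ => rfl
      commutes' := fun q => Subtype.ext (by simp) }
  have hf : Function.Bijective f :=
    ⟨fun a b hab => Subtype.ext (congrArg (fun w : IdeleClassGroup.muAlgValueField E μ => (w : ℂ)) hab),
      fun w => ⟨⟨(w : ℂ), (mem_fieldOfValues_iff E μ w).2 w.2⟩, rfl⟩⟩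
  exact (AlgEquiv.ofBijective f hf).toLinearEquiv.finrank_eq

/-- **`[M_μ:ℚ] = 2 dim (A_μ ⊗ ℂ)`** — the PROJECTION `hdimOne` of the chosen Def. 4.5 (2) datum («`A_μ` has dimension `[M_μ:ℚ]/2`», l. 650;
READING I1-R3 of `Def45AsPrinted`), with `dim` invariant under base change. [cite: Liu2021, l. 650 with Def. 4.5 (2) (FJcycle.tex l. 1948)] -/
theorem finrank_fieldOfValues_eq_two_mul_dim (D : ObjOne emb ιg hμ hw Car) :
    Module.finrank ℚ (fieldOfValues E μ) = 2 * (AμC emb ιg hμ hw Car D).dim := by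
  rw [finrank_fieldOfValues_eq, AbelianVariety.dim_baseChange]
  exact hdimOne emb ιg hμ hw Car D

/-- **The `M_μ`-module structure on `L = H¹_B(A_μ ⊗ ℂ; ℚ)` through `i_μ`** (a `def`; `letI` at the pin — the `[Module (fieldOfValues E μ) L]`
input of `map43RecordOfLevels`). [cite: Liu2021, Def. 4.5 (2) (FJcycle.tex l. 1948) and Def. 4.16 (l. 2219)] -/
abbrev lineModuleOne (D : ObjOne emb ιg hμ hw Car) :
    Module (fieldOfValues E μ) (bettiCohomology (AμC emb ιg hμ hw Car D).X 1) :=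
  lineModule (AμC emb ιg hμ hw Car D) (fieldOfValues E μ) (jOne emb ιg hμ hw Car D)

/-- Its scalar tower over `ℚ` (the `[IsScalarTower ℚ (fieldOfValues E μ) L]` input). [folklore] -/
theorem isScalarTower_lineModuleOne (D : ObjOne emb ιg hμ hw Car) :
    letI := lineModuleOne emb ιg hμ hw Car D
    IsScalarTower ℚ (fieldOfValues E μ) (bettiCohomology (AμC emb ιg hμ hw Car D).X 1) :=
  isScalarTower_lineModule _ _ _

/-- **`rank_L` at the one-object rest**: `H¹_B(A_μ ⊗ ℂ; ℚ)` is an `M_μ`-line. [cite: Liu2021, l. 650 with Def. 4.5 (2)] [cite: Deligne1982HodgeCycles, I §4 p. 30] -/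
theorem finrank_lineModuleOne (D : ObjOne emb ιg hμ hw Car) :
    letI := lineModuleOne emb ιg hμ hw Car D
    Module.finrank (fieldOfValues E μ) (bettiCohomology (AμC emb ιg hμ hw Car D).X 1) = 1 := by
  haveI : FiniteDimensional ℚ (fieldOfValues E μ) := (numberField_fieldOfValues hμ).to_finiteDimensional
  exact finrank_lineModule _ _ _ (finrank_fieldOfValues_eq_two_mul_dim emb ιg hμ hw Car D)

/-- **`α ∕ α_mem ∕ α_ne` at the one-object rest**: a non-zero `M_μ`-eigenvector of `ℂ ⊗_ℚ H¹_B(A_μ ⊗ ℂ; ℚ)` for the inclusion `M_μ ⊆ ℂ`.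
[cite: Liu2021, proof of Thm. 4.18 (FJcycle.tex l. 2250)] -/
theorem exists_eigenvectorOne (D : ObjOne emb ιg hμ hw Car) :
    letI := lineModuleOne emb ιg hμ hw Car D
    ∃ α : ℂ ⊗[ℚ] bettiCohomology (AμC emb ιg hμ hw Car D).X 1,
      (∀ s : fieldOfValues E μ,
        (DistribSMul.toLinearMap ℚ (bettiCohomology (AμC emb ιg hμ hw Car D).X 1) s).baseChange ℂ α =
          algebraMap (fieldOfValues E μ) ℂ s • α) ∧ α ≠ 0 := by
  haveI : FiniteDimensional ℚ (fieldOfValues E μ) := (numberField_fieldOfValues hμ).to_finiteDimensional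
  exact exists_eigenvector _ _ _ (finrank_fieldOfValues_eq_two_mul_dim emb ιg hμ hw Car D)

/-- **`endStarQ` on `End⁰(A_μ)`** (over `E`): `e ↦ (e ⊗ ℂ)^*` on `H¹_B(A_μ ⊗ ℂ; ℚ)` — the `endStarQ` input of `map43RecordOfLevels`, `ℚ`-linear.
[cite: MumfordAV1970, §19] -/
def endStarQOne (D : ObjOne emb ιg hμ hw Car) :
    (AμOne emb ιg hμ hw Car D).endAlgebra →ₗ[ℚ] Module.End ℚ (bettiCohomology (AμC emb ιg hμ hw Car D).X 1) :=
  endStarQ (AμC emb ιg hμ hw Car D) ∘ₗ (AbelianVariety.endAlgebra.mapRingHom ((AμOne emb ιg hμ hw Car D).endBaseChange ℂ)).toLinearMap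

/-- **`hmod` at the one-object rest, by `rfl`**: `s • x = endStarQOne (i_μ s) x` with `i_μ s = EndScalar.hom s` (the scoped instance
`RestOne.endScalarOne`). [cite: Liu2021, Def. 4.16 (FJcycle.tex l. 2219)] -/
theorem smul_eq_endStarQOne (D : ObjOne emb ιg hμ hw Car) (s : fieldOfValues E μ)
    (x : bettiCohomology (AμC emb ιg hμ hw Car D).X 1) :
    (letI := lineModuleOne emb ιg hμ hw Car D; s • x) =
      endStarQOne emb ιg hμ hw Car D (EndScalar.hom (B := AμOne emb ιg hμ hw Car D) s) x :=
  rfl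

/-- On `1 ⊗ β`, `β ∈ End_E(A_μ)`: `endStarQOne (1 ⊗ β) = (β ⊗ ℂ)^*` (the `hpost` currency: pull-back along the base-changed endomorphism).
[cite: MumfordAV1970, §19 (p. 176)] -/
theorem endStarQOne_of (D : ObjOne emb ιg hμ hw Car) (β : End (AμOne emb ιg hμ hw Car D)) :
    endStarQOne emb ιg hμ hw Car D (AbelianVariety.endAlgebra.of _ β) =
      (bettiCohomology.map (AbelianVariety.Hom.baseChange ℂ β).hom.hom.hom 1).hom := by
  rw [endStarQOne, LinearMap.comp_apply, AlgHom.toLinearMap_apply]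
  have h : AbelianVariety.endAlgebra.mapRingHom ((AμOne emb ιg hμ hw Car D).endBaseChange ℂ)
      (AbelianVariety.endAlgebra.of _ β) = AbelianVariety.endAlgebra.of _ (AbelianVariety.Hom.baseChange ℂ β) := by
    change AbelianVariety.endAlgebra.mapRingHom _ ((1 : ℚ) ⊗ₜ[ℤ] β) = ((1 : ℚ) ⊗ₜ[ℤ] _ : (AμC emb ιg hμ hw Car D).endAlgebra)
    rw [AbelianVariety.endAlgebra.mapRingHom_tmul]
    rfl
  rw [h, endStarQ_of]

end OneObject

end Summit.HodgeConjecture.CorCM.D2Bridge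

end
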